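import Literature.MathematicalPhysics.QuantumFieldTheory.Balaban1983to89.B6Eq292MemberTorusV1
import Literature.MathematicalPhysics.QuantumFieldTheory.Balaban1983to89.B6Prop26KLevelSkeletonV2
import Literature.MathematicalPhysics.QuantumFieldTheory.Balaban1983to89.B6AgreeQaQV1Chart
import Literature.MathematicalPhysics.QuantumFieldTheory.Balaban1983to89.B6CubeCoeffSizesV1

/-!
# `Balaban1983to89.B6CubeMoutV1` — T. Bałaban, *Propagators and renormalization transformations for lattice gauge theories. II*,
# Commun. Math. Phys. **96** (1984) 223–250 [Balaban1984PropagatorsII], (2.92)–(2.93) p. 239, p. 247 (the supports of h_□, ζ_□ lie in □̃ — a paraphrase of p. 239's ζ_□ sentence, not a quotation; v1.2 docfix):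
# THE OUTPUT LOCALISATION `hMout` OF `M_□h_□` OVER `□̃` FOR THE GENUINE MEMBER OF A CUBE ON THE GLOBAL TORUS — the local operator
# `M_□ = s(□)·τ_{−v}ε(Δ_□ + Q*a_□Q)ρτ_v` of `T_□` applied after the cut-off `h_□` has outputs on the blocks of `□̃ = QbigT □` (radius `7S/4`)

statement-level skeleton of published theorems with citation tags; proofs where landed; nothing here is a claim about the Yang–Mills mass gap

PDF held: `paper:balaban1984-cmp96-propagators-rt-ii` (journal page = PDF page + 222): p. 239 [PDF 17] re-read (text layer): *"On this torus we define
operators R, Δ_a as in (2.17), (2.19), but only two scales are present now … G_□ = (Δ − ∂P_□∂* + Q*aQ)⁻¹ (2.90) … K_{□,□}(x) = Σ_{b∈st(x)}(∂h_□)(b)(∂A_μ)(b)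
− (Δh_□)(x)A_μ(x) … (2.92)"*, p. 239 *"The function ζ_□ is of the same type as h_□, but it is equal to 1 on a cube containing □ … and it is equal to 0 outside a similar cube"*
(v1.2 DOCFIX, ref-4 D-g67-1: v1/v1.1 carried «these functions have supports in □̃» in quotation marks attributed to p. 247 — that clause is OUR
PARAPHRASE, not print; Lean content unchanged); [Balaban1984PropagatorsI] (1.8), (1.11) p. 19 (a block average
`(Q_kA)(c)` only sees the fine bonds of `B(c₋) ∪ B(c₊)`).

CITATION HEADER (lean-in-tree rule) — WHAT IS REPRODUCED.  Phase-2 file of the `lit-balaban` typed skeleton, seat **p38 gen 28**; the B6 fold owner r03's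
finding F5 (ii) (seat INBOX 2026-08-23T07:38Z/07:55Z: *"hMout : ∀ c, OutLoc (geomT D) (blkV1 hN D) (Ml c * mulOp (hB c)) (SbigT c) — needed because K's
first term (h_□M_□ − M_□h_□) contains M_□h_□ un-sandwiched"*) — the displayed hypothesis (ii) of `…B6Prop26KLevelAssemblyV1.prop26_2136_kLevel_assembly`
(p358050).  SKELETON rows **B6.Eq2.92** × **B6.Eq2.93** × **B6.Prop2.6** (cells only; decls of record untouched).  IMPORTS BY NAME, restating nothing:
`…B6Eq292MemberTorusV1` (`NC`, `EC`, `cfC`, `c0C`, `zC`, **`hdec_cube`**: `h_□M_□ − M_□h_□ = (Σ_e c_e·E_e − c₀·) + z·(Nh_□ − h_□N)`), `…B6CubeWindowV1` (`Ml`, `tC`, `hch`, `hch_deep`, `trV_hB`), `…B6AgreeQaQV1Chart` (`toMatrix'_memberQaQ`,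
`blocks_of_bondAvgIter_single_ne_zero`, `sitesPerDir_zero_eq_mul`), `…B6AgreeLapV1Chart` (`eS/eB`, `DeepS`, `cB`, `val_eS`, `apply_eq_sum_toMatrix`),
`…B6Prop26KLevelSkeletonV2` (`SbigT`, `blkV1_mem_SbigT_of_hB_ne_zero`, `ST_subset_SbigT`), `…B6Partition118KLevelTorusCentral` (`Dch`, `cc`, `QbigT`,
`blkDeep_of_hF_ne_zero`), `…B6Partition118KLevelFineLip` (`Qbig`, `mem_Qbig`), `…B6TorusDepthDistance` (`min_le_torusSupNorm_sub`), `…B6TranslateTorusV1`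
(`TB`, `vch`, `outLoc_conj_chart`, `mulOp_eq_conj`), `…B5Eq118OneStroke` (`iterBlockOf`, `val_iterBlockOf`), `…B6Prop26Gluing` (`OutLoc`, `outLoc_mulOp_mul`).

THIS FILE (0 sorry; standard axioms; THEOREMS ONLY — no `def`, no `def … : Prop` fact, no hypothesis-shaped fact).
* §1 LABELS: `one_lt_sitesPerDir`, `label_bounds` (`q·L^{j′} ≤ x − x₀ < (q+1)·L^{j′}` for the member `j′`-block label `q` of a charted window site),
  `label_window` (a site of margin `r·L^{j′}` has `r ≤ q < N′_{j′} − r`), `val_tgt` (the label of `β₊` is `a`, `a + 1`, or wraps to `0`),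
  **`abs_sub_lt_of_common_block`**: two window sites whose member `j′`-blocks are end-blocks of ONE member `j′`-bond, one of them of margin `4L^{j′}`, have
  labels `< 2L^{j′}` apart (the member torus does not wrap there).
* §2 **`exists_of_memberQaQ_ne_zero`**: a nonzero entry `(Q*a_□Q)(b′, b′₁)` of the member's sandwich forces a member index bond `β′` of level `j′ ∈ {j, j+1}`
  whose averages see both `δ_{b′}` and `δ_{b′₁}` (the kernel `Σ_{Λ^c} + Σ_{Λ′}` of `toMatrix'_memberQaQ`).
* §3 **`blkOf_mem_Qbig_of_near_hF`**: a chart site within torus distance `S/2` of `supp h^F_□` has its block in `Qbig` (radius `7S/4`; `M_h ≥ 8`: carriers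
  are `S_k`-deep so the torus distance is the box distance, block side `≤ L^{j+1} ≤ S/8`).
* §4 THE CUBE: `torusSupNorm_le_of_memberQaQ` (`(Q*a_□Q)(e b, e b₁) ≠ 0`, `h^ch_□(b₁) ≠ 0 ⟹ |b₋ − b₁₋|_T ≤ S/2`), **`outLoc_QaQ_hch_chart`** (chart frame:
  `(s(□)•ε(Q*a_□Q)ρ)·(h^ch_□·)` has outputs on the blocks of `Qbig`), **`outLoc_NC_hB`** (global frame by `outLoc_conj_chart`: `N·(h_□·)` has outputs on
  `SbigT □`), and the capstone **`outLoc_Ml_hB`**: `OutLoc (geomT D) (blkV1 hN D) (Ml □ * mulOp (hB □)) (SbigT □)` — by parts through `hdec_cube`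
  (`M_□h_□ = h_□M_□ − [(Σ_e c_e·E_e − c₀·) + z·(Nh_□ − h_□N)]`: `supp h_□ ⊂ □⁺ ⊂ □̃`, `supp c_e, supp c₀ ⊂ □⁺` — entering as the
  hypotheses `hcfT`/`hc0T`, literally r03's displayed hypotheses (iii), which p38's `…B6CubeCoeffSizesV1.cfC_supp`/`c0C_supp` (v1.1, p358610)
  discharge — and `N·(h_□·)`).
* §5 (v1.1, APPEND-ONLY; `import …B6CubeCoeffSizesV1` added) **`outLoc_Ml_hB'`**: the same with `hcfT`/`hc0T` DISCHARGED inside by `cfC_supp`/`c0C_supp`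
  (both in the tree, b1b9615ce29b) — hypothesis (ii) as a closed `∀ c` under the regime `M_h = L^a ≥ 8`, `R ≥ 2L²`, `P′ ≥ 5`, placed cube.

HONEST SCOPE / DIVERGENCES. (i) Lattice units, `η = 1`; V1 global torus, chart frame of the cube as in `…B6CubeWindowV1` (`M_h = L^a ≥ 8`, `R ≥ 2L²`,
`P′_μ ≥ 5`, placed cube).  (ii) Print's `□̃` is the cube of (2.93) («2/3M»); the tree's `□̃ = QbigT □` is p21/p38's block set of radius `7S/4` — the set over
which r03's assembly localises `K`; this file proves the localisation for THAT set (in fact the outputs of `M_□h_□` lie within `S + S/4 + L^{j+1}` of the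
centre).  (iii) Pure bookkeeping of supports: no estimate of [6] is involved; the only inputs are the locality of block averages ((1.8)/(1.11) of
[Balaban1984PropagatorsI], r03's `blocks_of_bondAvgIter_single_ne_zero`) and the depth of `supp h_□` in the window (`hch_deep`).  Nothing on d = 4 or the
continuum; NOT summit progress.  Unit `lit-balaban-p38` (gen 28: v1 p359177 b629576cfa6b; v1.1 §5), 2026-08-23.
-/

noncomputable section

open scoped BigOperators
open Finset

namespace Literature.MathematicalPhysics.QuantumFieldTheory.Balaban1983to89.B6CubeMoutV1

open LatticeFieldCalculus (bondAvgIter)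
open B4ContourShift (supNorm abs_le_supNorm)
open B4Reflection242 (boxDom)
open B4TorusKernel.MultiPeriod (torusSupNorm torusSupNorm_le_supNorm)
open B6MultiLevelBoxOperator (N0 bigSide)
open B6MultiLevelTorusOperator (TDomains one_le_of_mem)
open B6Geom246MultiLevelBox (bset blkOf toR supNorm_eq_dist dist_toR_cen_le cen)
open B6Geom246MultiLevelTorus (geomT blkMap torusSupNorm_neg)
open B6Cover236MultiLevelBlocks (cubes side ctr)
open B6Eq238MultiLevelTorus (svec)
open B6Partition118KLevelFine (hF dist_lt_of_hF_ne_zero lev_window_of_dist_lt_three_halves)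
open B6Partition118KLevelFineLip (Qbig mem_Qbig)
open B6Partition118KLevelTorusCentral (Dch cc QbigT side_cc level_bounds blkDeep_of_hF_ne_zero)
open B6TorusDepthDistance (SiteDeep min_le_torusSupNorm_sub)
open B6CubeWindowV1 (one_le_bigSide_real)
open B5Eq118OneStroke (iterBlockOf val_iterBlockOf)

variable {d ℓ : ℕ}

/-! ## §1  Labels: two window sites under one member index bond are `2L^{j′}`-close -/

section Labels

open B6GlobalChartV1 (PV)
open B6Prop25TwoScaleCensus (TSIdx)
open B6AgreeLapV1Chart (eS DeepS val_eS deepS_mono)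
open B6AgreeQaQV1Chart (sitesPerDir_zero_eq_mul)

variable {hd : 1 ≤ d + 1} {hL : Odd (ℓ + 1) ∧ 1 < ℓ + 1} {a₀ a₁ : ℝ} {m K : ℕ}
variable {t : TSIdx d (ℓ + 1) hd hL a₀ a₁} {x₀ : Fin (d + 1) → ℤ}

/-- every torus `T^{(j)}` of the standing conventions has at least two sites per direction (`2L^{m+K−j}`). [cite: Balaban1987RG1, (0.1) p.251, dictionary] -/
theorem one_lt_sitesPerDir (P : Params) (j : ℕ) : 1 < P.sitesPerDir j := by
  unfold Params.sitesPerDir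
  have := Nat.one_le_pow (P.m + P.K - j) P.L P.L_pos
  omega

/-- **THE BLOCK LABEL BRACKETS THE SITE LABEL**: for a window site `z` (margin `0`) with member `j′`-block label `q = ((val z − x₀)/L^{j′})`,
`q·L^{j′} ≤ val z − x₀ < q·L^{j′} + L^{j′}`. [cite: Balaban1984PropagatorsI, (1.6) p.18, (1.18) p.20 (blocks B^k(y)); Balaban1984PropagatorsII, p.238, dictionary] -/
theorem label_bounds {j' : ℕ} (hj't : j' ≤ t.m + t.K) {z : Site (PV d ℓ m K hd hL) 0} (hz : z ∈ DeepS t x₀ 0) (μ : Fin (d + 1)) :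
    (((iterBlockOf j' (eS t x₀ z)) μ).val : ℤ) * (((ℓ + 1) ^ j' : ℕ) : ℤ) ≤ ((z μ).val : ℤ) - x₀ μ ∧
      ((z μ).val : ℤ) - x₀ μ < (((iterBlockOf j' (eS t x₀ z)) μ).val : ℤ) * (((ℓ + 1) ^ j' : ℕ) : ℤ) + (((ℓ + 1) ^ j' : ℕ) : ℤ) := by
  have hLj : 0 < (ℓ + 1) ^ j' := by positivity
  have hq : ((iterBlockOf j' (eS t x₀ z)) μ).val = ((eS t x₀ z) μ).val / (ℓ + 1) ^ j' := val_iterBlockOf (P := t.P) j' hj't _ μ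
  have he : ((((eS t x₀ z) μ).val : ℕ) : ℤ) = ((z μ).val : ℤ) - x₀ μ := val_eS hz μ
  have h1 := Nat.div_mul_le_self (((eS t x₀ z) μ).val) ((ℓ + 1) ^ j')
  have h2 := Nat.lt_div_mul_add (a := ((eS t x₀ z) μ).val) hLj
  rw [← hq] at h1 h2
  rw [← he]
  constructor
  · exact_mod_cast h1
  · exact_mod_cast h2

/-- **A SITE OF MARGIN `r·L^{j′}` HAS ITS `j′`-BLOCK LABEL IN `[r, N′_{j′} − r)`** (the member period is `L^{j′}·N′_{j′}`).
[cite: Balaban1984PropagatorsII, p.238 (□̃ ⊂ T_□ built of blocks), dictionary] -/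
theorem label_window {j' : ℕ} (hj't : j' ≤ t.m + t.K) {z : Site (PV d ℓ m K hd hL) 0} {r : ℕ} (hz : z ∈ DeepS t x₀ (r * (ℓ + 1) ^ j'))
    (μ : Fin (d + 1)) :
    r ≤ ((iterBlockOf j' (eS t x₀ z)) μ).val ∧ ((iterBlockOf j' (eS t x₀ z)) μ).val + r < t.P.sitesPerDir j' := by
  have hLj : 0 < (ℓ + 1) ^ j' := by positivity
  have hz0 : z ∈ DeepS t x₀ 0 := deepS_mono (Nat.zero_le _) hz
  have hq : ((iterBlockOf j' (eS t x₀ z)) μ).val = ((eS t x₀ z) μ).val / (ℓ + 1) ^ j' := val_iterBlockOf (P := t.P) j' hj't _ μ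
  have he : ((((eS t x₀ z) μ).val : ℕ) : ℤ) = ((z μ).val : ℤ) - x₀ μ := val_eS hz0 μ
  have hN : t.P.sitesPerDir 0 = (ℓ + 1) ^ j' * t.P.sitesPerDir j' := sitesPerDir_zero_eq_mul t.P hj't
  obtain ⟨hz1, hz2⟩ := hz μ
  rw [hN] at hz2
  have hlo : r * (ℓ + 1) ^ j' ≤ ((eS t x₀ z) μ).val := by
    have : ((r * (ℓ + 1) ^ j' : ℕ) : ℤ) ≤ ((((eS t x₀ z) μ).val : ℕ) : ℤ) := by rw [he]; omega
    exact_mod_cast this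
  have hhi' : ((eS t x₀ z) μ).val + r * (ℓ + 1) ^ j' < (ℓ + 1) ^ j' * t.P.sitesPerDir j' := by
    have : ((((eS t x₀ z) μ).val : ℕ) : ℤ) + ((r * (ℓ + 1) ^ j' : ℕ) : ℤ) < (((ℓ + 1) ^ j' * t.P.sitesPerDir j' : ℕ) : ℤ) := by
      rw [he]; omega
    exact_mod_cast this
  have hcomm : (ℓ + 1) ^ j' * t.P.sitesPerDir j' = t.P.sitesPerDir j' * (ℓ + 1) ^ j' := Nat.mul_comm _ _
  have hsub : (t.P.sitesPerDir j' - r) * (ℓ + 1) ^ j' = t.P.sitesPerDir j' * (ℓ + 1) ^ j' - r * (ℓ + 1) ^ j' := Nat.sub_mul _ _ _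
  have hhi : ((eS t x₀ z) μ).val < (t.P.sitesPerDir j' - r) * (ℓ + 1) ^ j' := by rw [hsub]; omega
  rw [hq]
  constructor
  · exact (Nat.le_div_iff_mul_le hLj).2 hlo
  · have := (Nat.div_lt_iff_lt_mul hLj).2 hhi
    omega

/-- the label of the target `β₊ = β₋ + e_{dir}` of a `j′`-bond: the label of `β₋` off the direction; along it `a + 1`, or `0` when `a + 1 = N′_{j′}` wraps.
[cite: Balaban1987RG1, (0.1) p.251, dictionary (torus labels)] -/
theorem val_tgt {j' : ℕ} (β' : PBond t.P j') (μ : Fin (d + 1)) :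
    (β'.tgt μ).val = (β'.src μ).val ∨ (β'.tgt μ).val = (β'.src μ).val + 1 ∨
      ((β'.tgt μ).val = 0 ∧ (β'.src μ).val + 1 = t.P.sitesPerDir j') := by
  by_cases hμ : μ = β'.dir
  · subst hμ
    have h1n : 1 < t.P.sitesPerDir j' := one_lt_sitesPerDir t.P j'
    have hsh : β'.tgt β'.dir = β'.src β'.dir + 1 := by simp [PBond.tgt, Site.shift]
    have hv : (β'.tgt β'.dir).val = ((β'.src β'.dir).val + 1) % t.P.sitesPerDir j' := by
      rw [hsh, ZMod.val_add, ZMod.val_one_eq_one_mod, Nat.mod_eq_of_lt h1n]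
    have ha : (β'.src β'.dir).val < t.P.sitesPerDir j' := ZMod.val_lt _
    rw [hv]
    rcases lt_or_ge ((β'.src β'.dir).val + 1) (t.P.sitesPerDir j') with hlt | hge
    · exact Or.inr (Or.inl (Nat.mod_eq_of_lt hlt))
    · have heq : (β'.src β'.dir).val + 1 = t.P.sitesPerDir j' := by omega
      exact Or.inr (Or.inr ⟨by rw [heq, Nat.mod_self], heq⟩)
  · have hsh : β'.tgt μ = β'.src μ := by simp [PBond.tgt, Site.shift, Function.update_of_ne hμ]
    exact Or.inl (by rw [hsh])

/-- **TWO WINDOW SITES UNDER ONE MEMBER INDEX BOND ARE `2L^{j′}`-CLOSE**: if the member `j′`-blocks of the charted window sites `y`, `x₁` are end-blocks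
of one member `j′`-bond `β′` and `x₁` has margin `4L^{j′}`, then `|val y_μ − val x₁_μ| < 2L^{j′}` for every `μ` (the two labels bracket sites at block
distance `≤ 1`; the wrap of `β′₊` to label `0` is excluded by the margin of `x₁`). [cite: Balaban1984PropagatorsI, (1.8), (1.11) p.19 (B(c₋) ∪ B(c₊)); Balaban1984PropagatorsII, p.238 (□ ⊂ □̃³ ⊂ T_□), dictionary] -/
theorem abs_sub_lt_of_common_block {j' : ℕ} (hj't : j' ≤ t.m + t.K) {y x₁ : Site (PV d ℓ m K hd hL) 0} (hy : y ∈ DeepS t x₀ 0)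
    (hx₁ : x₁ ∈ DeepS t x₀ (4 * (ℓ + 1) ^ j')) {β' : PBond t.P j'}
    (hby : iterBlockOf j' (eS t x₀ y) = β'.src ∨ iterBlockOf j' (eS t x₀ y) = β'.tgt)
    (hbx : iterBlockOf j' (eS t x₀ x₁) = β'.src ∨ iterBlockOf j' (eS t x₀ x₁) = β'.tgt) (μ : Fin (d + 1)) :
    |((y μ).val : ℤ) - (x₁ μ).val| < 2 * (((ℓ + 1) ^ j' : ℕ) : ℤ) := by
  have hx₁0 : x₁ ∈ DeepS t x₀ 0 := deepS_mono (Nat.zero_le _) hx₁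
  obtain ⟨hy1, hy2⟩ := label_bounds hj't hy μ
  obtain ⟨hx1, hx2⟩ := label_bounds hj't hx₁0 μ
  obtain ⟨hq1lo, hq1hi⟩ := label_window hj't hx₁ μ
  have ha : (β'.src μ).val < t.P.sitesPerDir j' := ZMod.val_lt _
  -- the two block labels as labels of `β′₋` / `β′₊`
  have hcy : ((iterBlockOf j' (eS t x₀ y)) μ).val = (β'.src μ).val ∨ ((iterBlockOf j' (eS t x₀ y)) μ).val = (β'.tgt μ).val := by
    rcases hby with h | h
    · exact Or.inl (by rw [h])
    · exact Or.inr (by rw [h])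
  have hcx : ((iterBlockOf j' (eS t x₀ x₁)) μ).val = (β'.src μ).val ∨ ((iterBlockOf j' (eS t x₀ x₁)) μ).val = (β'.tgt μ).val := by
    rcases hbx with h | h
    · exact Or.inl (by rw [h])
    · exact Or.inr (by rw [h])
  have htgt := val_tgt β' μ
  -- block distance ≤ 1 (the wrap is excluded by `4 ≤ q₁ < N′ − 4`)
  have hq : ((iterBlockOf j' (eS t x₀ y)) μ).val = ((iterBlockOf j' (eS t x₀ x₁)) μ).val ∨
      ((iterBlockOf j' (eS t x₀ y)) μ).val = ((iterBlockOf j' (eS t x₀ x₁)) μ).val + 1 ∨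
      ((iterBlockOf j' (eS t x₀ x₁)) μ).val = ((iterBlockOf j' (eS t x₀ y)) μ).val + 1 := by
    omega
  -- the bracketed labels are then `< 2L^{j′}` apart
  have hL0 : (0 : ℤ) < (((ℓ + 1) ^ j' : ℕ) : ℤ) := by positivity
  rw [abs_sub_lt_iff]
  rcases hq with h | h | h
  · rw [h] at hy1 hy2
    constructor <;> omega
  · have e : ((((iterBlockOf j' (eS t x₀ y)) μ).val : ℕ) : ℤ) * (((ℓ + 1) ^ j' : ℕ) : ℤ) =
        ((((iterBlockOf j' (eS t x₀ x₁)) μ).val : ℕ) : ℤ) * (((ℓ + 1) ^ j' : ℕ) : ℤ) + (((ℓ + 1) ^ j' : ℕ) : ℤ) := by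
      rw [h]; push_cast; ring
    rw [e] at hy1 hy2
    constructor <;> omega
  · have e : ((((iterBlockOf j' (eS t x₀ x₁)) μ).val : ℕ) : ℤ) * (((ℓ + 1) ^ j' : ℕ) : ℤ) =
        ((((iterBlockOf j' (eS t x₀ y)) μ).val : ℕ) : ℤ) * (((ℓ + 1) ^ j' : ℕ) : ℤ) + (((ℓ + 1) ^ j' : ℕ) : ℤ) := by
      rw [h]; push_cast; ring
    rw [e] at hx1 hx2
    constructor <;> omega

end Labels

/-! ## §2  A nonzero entry of the member's `Q*a_□Q` forces a common index bond of level `j` or `j + 1` -/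

section Kernel

open B6Ineq2133TwoScaleV1 (onFun)
open B6Prop25TwoScaleCensus (TSIdx)
open B6SectCTwoScaleV1 (OutBond InBond)
open B6AgreeQaQV1Chart (toMatrix'_memberQaQ)

variable {hd : 1 ≤ d + 1} {hL : Odd (ℓ + 1) ∧ 1 < ℓ + 1} {a₀ a₁ : ℝ}

/-- **A NONZERO ENTRY `(Q*a_□Q)(b′, b′₁)` OF THE MEMBER'S SANDWICH FORCES A COMMON INDEX BOND**: some member bond `β′` of level `j′ ∈ {j, j+1}` (a
`Λ^c`-bond or a `Λ′`-bond of (2.89)) has `(Q_{j′}δ_{b′})(β′) ≠ 0` and `(Q_{j′}δ_{b′₁})(β′) ≠ 0` (the kernel is `Σ_i Q(i,b′)w_iQ(i,b′₁)`).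
[cite: Balaban1984PropagatorsII, (2.89)–(2.90) p.239, (2.18)–(2.20) p.226, dictionary] -/
theorem exists_of_memberQaQ_ne_zero (t : TSIdx d (ℓ + 1) hd hL a₀ a₁) {b' b'₁ : PBond t.P 0}
    (h : LinearMap.toMatrix' (onFun (LinearMap.adjoint t.D.Q ∘ₗ t.D.a ∘ₗ t.D.Q)) b' b'₁ ≠ 0) :
    ∃ j' : ℕ, (j' = t.j ∨ j' = t.j + 1) ∧ ∃ β' : PBond t.P j',
      bondAvgIter j' (Pi.single b' (1 : ℝ)) β' ≠ 0 ∧ bondAvgIter j' (Pi.single b'₁ (1 : ℝ)) β' ≠ 0 := by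
  rw [toMatrix'_memberQaQ] at h
  by_cases h1 : ∑ β' : OutBond t.j t.Λ', bondAvgIter t.j (Pi.single b' (1 : ℝ)) β'.1 *
      (t.w (Sum.inl β') * bondAvgIter t.j (Pi.single b'₁ (1 : ℝ)) β'.1) = 0
  · rw [h1, zero_add] at h
    obtain ⟨η', -, hη'⟩ := Finset.exists_ne_zero_of_sum_ne_zero h
    exact ⟨t.j + 1, Or.inr rfl, η'.1, (mul_ne_zero_iff.1 hη').1, (mul_ne_zero_iff.1 (mul_ne_zero_iff.1 hη').2).2⟩
  · obtain ⟨β', -, hβ'⟩ := Finset.exists_ne_zero_of_sum_ne_zero h1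
    exact ⟨t.j, Or.inl rfl, β'.1, (mul_ne_zero_iff.1 hβ').1, (mul_ne_zero_iff.1 (mul_ne_zero_iff.1 hβ').2).2⟩

end Kernel

/-! ## §3  Chart geometry: a site within torus distance `S/2` of `supp h^F_□` has its block in `Qbig` -/

section Geometry

variable {Mh k R : ℕ} {P : Fin (d + 1) → ℕ} (D : TDomains d ℓ Mh k P R)

/-- **THE BLOCKS WITHIN `S/2` OF `supp h^F_□` LIE IN `Qbig`** (`M_h ≥ 8`, `R ≥ 2L`, `P_μ ≥ 5`): `h^F_□(x′) ≠ 0`, `|x − x′|_T ≤ S/2 ⟹ y(x) ∈ Qbig □` (radius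
`7S/4`) — the carrier `x′` is `S_k`-deep so the torus distance is the box distance, `|x′ − ctr| < S`, and the block of `x` (level `≤ j+1`, side `≤ S/8`)
has its centre within `S + S/2 + S/16 ≤ 7S/4`. [cite: Balaban1984PropagatorsII, p.239 (supports of h_□, ζ_□ in □̃ — our paraphrase of p.239 «equal to 1 on a cube containing □ … equal to 0 outside a similar cube», not a printed sentence), p.235, (2.93) p.239, bookkeeping] -/
theorem blkOf_mem_Qbig_of_near_hF (hM8 : 8 ≤ Mh) (hR : 2 * (ℓ + 1) ≤ R) (hP5 : ∀ μ, 5 ≤ P μ) {hMh1 : 1 ≤ Mh} (hP4 : ∀ μ, 4 ≤ P μ)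
    (c : ↥(cubes D.toDomains)) {x x' : ↥(boxDom (N0 ℓ Mh k P))} (h : hF (Dch D c) (cc D hMh1 hP4 c) x' ≠ 0)
    (hxx' : torusSupNorm (N0 ℓ Mh k P) (x.1 - x'.1) ≤ (bigSide ℓ Mh c.1.1 : ℝ) / 2) :
    blkOf (Dch D c) x ∈ Qbig (Dch D c) (cc D hMh1 hP4 c) := by
  have hMh : 2 ≤ Mh := le_trans (by norm_num) hM8
  have hx'c := dist_lt_of_hF_ne_zero (Dch D c) hMh1 h
  have hS : side (Dch D c) (cc D hMh1 hP4 c) = (bigSide ℓ Mh c.1.1 : ℝ) := side_cc hMh1 hP4 c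
  have hS1 : (1 : ℝ) ≤ (bigSide ℓ Mh c.1.1 : ℝ) := one_le_bigSide_real hMh1 c.1.1
  -- the carrier is `S_k`-deep: torus distance = box distance up to `S_k > S/2`
  have hdeep : SiteDeep (N0 ℓ Mh k P) ((bigSide ℓ Mh k : ℕ) : ℤ) x'.1 := (blkDeep_of_hF_ne_zero hMh hR hP5 c h).1 x' rfl
  have hjk : c.1.1 ≤ k := (level_bounds D.toDomains c).2
  have hSk : (bigSide ℓ Mh c.1.1 : ℝ) ≤ (bigSide ℓ Mh k : ℝ) := by
    unfold bigSide
    exact_mod_cast Nat.mul_le_mul_left Mh (Nat.pow_le_pow_right (by omega) (by omega))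
  have hw : (0 : ℤ) < ((bigSide ℓ Mh k : ℕ) : ℤ) := by
    have : (1 : ℝ) ≤ (bigSide ℓ Mh k : ℝ) := hS1.trans hSk
    exact_mod_cast (show 0 < bigSide ℓ Mh k by exact_mod_cast (by linarith : (0 : ℝ) < (bigSide ℓ Mh k : ℝ)))
  have key := min_le_torusSupNorm_sub hw hdeep x.2
  have hsym : torusSupNorm (N0 ℓ Mh k P) (x'.1 - x.1) = torusSupNorm (N0 ℓ Mh k P) (x.1 - x'.1) := by
    rw [show x'.1 - x.1 = -(x.1 - x'.1) by abel, torusSupNorm_neg (one_le_of_mem x.2)]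
  rw [hsym] at key
  have hnear : dist (toR x.1) (toR x'.1) ≤ (bigSide ℓ Mh c.1.1 : ℝ) / 2 := by
    rw [dist_comm, ← supNorm_eq_dist]
    rcases min_choice (supNorm (x'.1 - x.1)) ((((bigSide ℓ Mh k : ℕ) : ℤ) : ℝ)) with hm | hm
    · rw [hm] at key; exact key.trans hxx'
    · rw [hm] at key; push_cast at key; linarith
  -- the block of `x` has level `≤ j + 1`
  have h32 : dist (toR x.1) (ctr (Dch D c) (cc D hMh1 hP4 c)) < 3 / 2 * side (Dch D c) (cc D hMh1 hP4 c) := by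
    rw [hS]; linarith [dist_triangle (toR x.1) (toR x'.1) (ctr (Dch D c) (cc D hMh1 hP4 c))]
  have hlev := (lev_window_of_dist_lt_three_halves (Dch D c) hMh1 hR h32).2
  have hcen := dist_toR_cen_le (Dch D c) (rfl : blkOf (Dch D c) x = blkOf (Dch D c) x)
  have hL1 : 1 ≤ ℓ + 1 := by omega
  have hpow : (((ℓ + 1) ^ (blkOf (Dch D c) x).1.1 : ℕ) : ℝ) ≤ (((ℓ + 1) ^ (c.1.1 + 1) : ℕ) : ℝ) := by
    exact_mod_cast Nat.pow_le_pow_right hL1 hlev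
  have h8 : 8 * (((ℓ + 1) ^ (c.1.1 + 1) : ℕ) : ℝ) ≤ side (Dch D c) (cc D hMh1 hP4 c) := by
    rw [hS]; unfold bigSide; push_cast
    have : (8 : ℝ) ≤ Mh := by exact_mod_cast hM8
    have hp : (0 : ℝ) ≤ ((ℓ : ℝ) + 1) ^ (c.1.1 + 1) := by positivity
    nlinarith
  refine (mem_Qbig (Dch D c)).2 ?_
  rw [hS] at h8 hx'c ⊢
  calc dist (cen (Dch D c) (blkOf (Dch D c) x)) (ctr (Dch D c) (cc D hMh1 hP4 c))
      ≤ dist (toR x.1) (cen (Dch D c) (blkOf (Dch D c) x)) + dist (toR x.1) (ctr (Dch D c) (cc D hMh1 hP4 c)) :=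
        dist_triangle_left _ _ _
    _ ≤ dist (toR x.1) (cen (Dch D c) (blkOf (Dch D c) x)) + (dist (toR x.1) (toR x'.1) +
          dist (toR x'.1) (ctr (Dch D c) (cc D hMh1 hP4 c))) := by
        linarith [dist_triangle (toR x.1) (toR x'.1) (ctr (Dch D c) (cc D hMh1 hP4 c))]
    _ ≤ 7 / 4 * (bigSide ℓ Mh c.1.1 : ℝ) := by linarith

end Geometry

/-! ## §4  The cube: `N·(h_□·)` and `M_□·(h_□·)` have outputs on `□̃ = SbigT □` -/

section Cube

open B6Ineq2133TwoScaleV1 (onFun)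
open B6GlobalChartV1 (PV domT toBox blkV1 toBox_apply)
open B6SectAOperatorsV1 (BondIdx)
open B6Prop25TwoScaleCensus (TSIdx)
open B6AgreeLapV1Chart (cB eB eS DeepS mem_cB_W deepS_mono transplant_eB_eq apply_eq_sum_toMatrix)
open B6AgreeQaQV1Chart (blocks_of_bondAvgIter_single_ne_zero)
open B6Prop26ReachTransplant (restrictOp transplant transplant_apply restrictOp_apply chartBond)
open B6Prop26Gluing (mulOp mulOp_apply OutLoc outLoc_mulOp_mul)
open B6TranslateTorusV1 (vch TB TB_mul_TB_neg mulOp_eq_conj outLoc_conj_chart)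
open B6Prop26KLevelSkeletonV1 (hB ST)
open B6Prop26KLevelSkeletonV2 (SbigT mem_SbigT ST_subset_SbigT blkV1_mem_SbigT_of_hB_ne_zero)
open B6CubeWindowV1 (tC tC_j sc x0 hx0 hfit wC hch hch_apply hch_deep Placed j0 j0_le_level Ml trV_hB)
open B6Eq292MemberTorusV1 (cfC c0C NC EC zC hdec_cube)

variable {hd : 1 ≤ d + 1} {hL : Odd (ℓ + 1) ∧ 1 < ℓ + 1} {a₀ a₁ : ℝ} {m K : ℕ} {Mh k R : ℕ} {P' : Fin (d + 1) → ℕ}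
variable (hN : ∀ μ, N0 ℓ Mh k P' μ = (PV d ℓ m K hd hL).sitesPerDir 0) {D : TDomains d ℓ Mh k P' R} (hk : k ≤ m + K)
  (hMh1 : 1 ≤ Mh) (hP4 : ∀ μ, 4 ≤ P' μ) {a : ℕ} (hMha : Mh = (ℓ + 1) ^ a) (c : ↥(cubes D.toDomains)) (ha : a₀ ≤ a₁)

include hMha in
/-- **A NONZERO ENTRY `(Q*a_□Q)(e b, e b₁)` WITH `h^ch_□(b₁) ≠ 0` PUTS `b₋` WITHIN `S/2` OF `b₁₋` ON THE TORUS** (`M_h ≥ 8`, `R ≥ 2L²`, window bond `b`):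
the two fine bonds lie under one member index bond of level `j′ ≤ j₀ + 1` (§2), `supp h^ch_□` has margin `4L^{j₀+1}` (`hch_deep`), so the labels are
`< 2L^{j′} ≤ 2L^{j+1} ≤ S/4` apart (§1). [cite: Balaban1984PropagatorsI, (1.8), (1.11) p.19; Balaban1984PropagatorsII, (2.89)–(2.90) p.239, p.238 (□ ⊂ □̃³)] -/
theorem torusSupNorm_le_of_memberQaQ (hM8 : 8 ≤ Mh) (hR2 : 2 * (ℓ + 1) ^ 2 ≤ R)
    (w : BondIdx (domT hN D hk) → ℝ) (cf : ℝ) {b b₁ : PBond (PV d ℓ m K hd hL) 0}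
    (hb : b.src ∈ DeepS (tC hN hk hMh1 hP4 c ha a (wC hN hk c w) cf) (x0 ℓ Mh k c.1) 0) (hb₁ : hch hN hMh1 hP4 c b₁ ≠ 0)
    (hK : LinearMap.toMatrix' (onFun (LinearMap.adjoint (tC hN hk hMh1 hP4 c ha a (wC hN hk c w) cf).D.Q ∘ₗ
        (tC hN hk hMh1 hP4 c ha a (wC hN hk c w) cf).D.a ∘ₗ (tC hN hk hMh1 hP4 c ha a (wC hN hk c w) cf).D.Q))
        (eB (tC hN hk hMh1 hP4 c ha a (wC hN hk c w) cf) (x0 ℓ Mh k c.1) b)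
        (eB (tC hN hk hMh1 hP4 c ha a (wC hN hk c w) cf) (x0 ℓ Mh k c.1) b₁) ≠ 0) :
    torusSupNorm (N0 ℓ Mh k P') ((toBox hN b.src).1 - (toBox hN b₁.src).1) ≤ (bigSide ℓ Mh c.1.1 : ℝ) / 2 := by
  obtain ⟨j', hj', β', hA, hA₁⟩ := exists_of_memberQaQ_ne_zero _ hK
  have hj0 : (tC hN hk hMh1 hP4 c ha a (wC hN hk c w) cf).j = j0 hMh1 hP4 c := rfl
  have hj'le : j' ≤ j0 hMh1 hP4 c + 1 := by omega
  have hj't : j' ≤ (tC hN hk hMh1 hP4 c ha a (wC hN hk c w) cf).m + (tC hN hk hMh1 hP4 c ha a (wC hN hk c w) cf).K := by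
    have := (tC hN hk hMh1 hP4 c ha a (wC hN hk c w) cf).hj
    omega
  -- `supp h^ch_□` has margin `4L^{j₀+1} ≥ 4L^{j′}`
  have hdeep₁ : b₁.src ∈ DeepS (tC hN hk hMh1 hP4 c ha a (wC hN hk c w) cf) (x0 ℓ Mh k c.1) (4 * (ℓ + 1) ^ j') :=
    deepS_mono (Nat.mul_le_mul_left 4 (Nat.pow_le_pow_right (by omega) hj'le)) (hch_deep hN hMh1 hP4 hMha c ha hM8 hR2 hb₁)
  -- the member blocks of `e b₋`, `e b₁₋` are end-blocks of `β′`
  have hBy := (blocks_of_bondAvgIter_single_ne_zero (P := (tC hN hk hMh1 hP4 c ha a (wC hN hk c w) cf).P) hj't hA).1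
  have hB₁ := (blocks_of_bondAvgIter_single_ne_zero (P := (tC hN hk hMh1 hP4 c ha a (wC hN hk c w) cf).P) hj't hA₁).1
  have hco : ∀ μ, |((b.src μ).val : ℤ) - (b₁.src μ).val| < 2 * (((ℓ + 1) ^ j' : ℕ) : ℤ) :=
    fun μ => abs_sub_lt_of_common_block hj't hb hdeep₁ hBy hB₁ μ
  -- torus distance ≤ label distance `< 2L^{j′} ≤ 2L^{j+1} ≤ S/4`
  have hN1 : ∀ i, 1 ≤ N0 ℓ Mh k P' i := one_le_of_mem (toBox hN b.src).2
  refine le_trans (torusSupNorm_le_supNorm hN1 _) ?_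
  have hjc : j' ≤ c.1.1 + 1 := le_trans hj'le (by have := (j0_le_level hMh1 hP4 c hL hR2).1; omega)
  have hl1 : (1 : ℝ) ≤ (ℓ : ℝ) + 1 := by have : (0 : ℝ) ≤ ℓ := Nat.cast_nonneg _; linarith
  have hpow : ((ℓ : ℝ) + 1) ^ j' ≤ ((ℓ : ℝ) + 1) ^ (c.1.1 + 1) := pow_le_pow_right₀ hl1 hjc
  have hM : (8 : ℝ) ≤ Mh := by exact_mod_cast hM8
  have eS : (bigSide ℓ Mh c.1.1 : ℝ) = (Mh : ℝ) * ((ℓ : ℝ) + 1) ^ (c.1.1 + 1) := by unfold bigSide; push_cast; ring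
  have hp0 : (0 : ℝ) ≤ ((ℓ : ℝ) + 1) ^ j' := by positivity
  refine Finset.sup'_le _ _ fun μ _ => ?_
  have hμ : (((|((toBox hN b.src).1 - (toBox hN b₁.src).1) μ| : ℤ)) : ℝ) ≤ 2 * ((ℓ : ℝ) + 1) ^ j' := by
    have h := (hco μ).le
    have : (((|((b.src μ).val : ℤ) - (b₁.src μ).val| : ℤ)) : ℝ) ≤ (((2 * (((ℓ + 1) ^ j' : ℕ) : ℤ)) : ℤ) : ℝ) := by exact_mod_cast h
    simpa using this
  rw [eS]
  nlinarith [mul_le_mul_of_nonneg_right hM (le_trans hp0 hpow)]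

include hMha in
/-- **`(s(□)•ε(Q*a_□Q)ρ)·(h^ch_□·)` HAS OUTPUTS ON THE BLOCKS OF `Qbig` (CHART FRAME)**: a nonzero output at a window bond `b` needs a window bond `b₁`
with `h^ch_□(b₁) ≠ 0` and `(Q*a_□Q)(e b, e b₁) ≠ 0`, whence `|b₋ − b₁₋|_T ≤ S/2` and the block of `b₋` is in `Qbig` (§3); off the window `ε = 0`.
[cite: Balaban1984PropagatorsII, (2.92)–(2.93) p.239 (supports of h_□, ζ_□ in □̃ — our paraphrase of p.239 «equal to 1 on a cube containing □ … equal to 0 outside a similar cube», not a printed sentence), p.247; Balaban1984PropagatorsI, (1.8), (1.11) p.19] -/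
theorem outLoc_QaQ_hch_chart (hM8 : 8 ≤ Mh) (hR2 : 2 * (ℓ + 1) ^ 2 ≤ R) (hP5 : ∀ μ, 5 ≤ P' μ) (hpl : Placed ℓ k P' c.1)
    (w : BondIdx (domT hN D hk) → ℝ) (cf : ℝ) :
    OutLoc (g := geomT (D.chart (svec ℓ k c.1.1 c.1.2))) (blkV1 hN (D.chart (svec ℓ k c.1.1 c.1.2)))
      ((sc hMh1 hP4 c cf • transplant (cB (tC hN hk hMh1 hP4 c ha a (wC hN hk c w) cf) (x0 ℓ Mh k c.1) (hx0 hpl) (hfit hN hMh1 hP4 hMha c ha hpl)).W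
          (eB (tC hN hk hMh1 hP4 c ha a (wC hN hk c w) cf) (x0 ℓ Mh k c.1))
          (onFun (LinearMap.adjoint (tC hN hk hMh1 hP4 c ha a (wC hN hk c w) cf).D.Q ∘ₗ (tC hN hk hMh1 hP4 c ha a (wC hN hk c w) cf).D.a ∘ₗ
            (tC hN hk hMh1 hP4 c ha a (wC hN hk c w) cf).D.Q))) *
        mulOp (hch hN hMh1 hP4 c))
      {y | y ∈ Qbig (Dch D c) (cc D hMh1 hP4 c)} := by
  have hR : 2 * (ℓ + 1) ≤ R := le_trans (by nlinarith : 2 * (ℓ + 1) ≤ 2 * (ℓ + 1) ^ 2) hR2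
  intro v b hb
  rw [Module.End.mul_apply, LinearMap.smul_apply, Pi.smul_apply, smul_eq_mul, transplant_apply]
  by_cases hW : b ∈ (cB (tC hN hk hMh1 hP4 c ha a (wC hN hk c w) cf) (x0 ℓ Mh k c.1) (hx0 hpl) (hfit hN hMh1 hP4 hMha c ha hpl)).W
  · rw [if_pos hW]
    refine mul_eq_zero_of_right _ ?_
    rw [apply_eq_sum_toMatrix]
    refine Finset.sum_eq_zero fun b'₁ _ => ?_
    by_contra hne
    obtain ⟨hK, hρ⟩ := mul_ne_zero_iff.1 hne
    rw [restrictOp_apply] at hρ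
    obtain ⟨b₁, hb₁W, hg⟩ := Finset.exists_ne_zero_of_sum_ne_zero hρ
    rw [Finset.mem_filter] at hb₁W
    rw [mulOp_apply] at hg
    have hch₁ : hch hN hMh1 hP4 c b₁ ≠ 0 := (mul_ne_zero_iff.1 hg).1
    rw [← hb₁W.2] at hK
    have hdist := torusSupNorm_le_of_memberQaQ hN hk hMh1 hP4 hMha c ha hM8 hR2 w cf (mem_cB_W.1 hW) hch₁ hK
    rw [hch_apply] at hch₁
    exact hb (blkOf_mem_Qbig_of_near_hF D hM8 hR hP5 hP4 c hch₁ hdist)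
  · rw [if_neg hW, mul_zero]

/-- `OutLoc` is additive. [folklore] -/
private theorem outLoc_add' {g : B6.Geometry} {X : Type} (blk : X → g.Site) {T T' : Module.End ℝ (X → ℝ)} {S : Set g.Site}
    (h : OutLoc blk T S) (h' : OutLoc blk T' S) : OutLoc blk (T + T') S := by
  intro v x hx
  rw [LinearMap.add_apply, Pi.add_apply, h v x hx, h' v x hx, add_zero]

/-- `OutLoc` passes to differences. [folklore] -/
private theorem outLoc_sub' {g : B6.Geometry} {X : Type} (blk : X → g.Site) {T T' : Module.End ℝ (X → ℝ)} {S : Set g.Site}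
    (h : OutLoc blk T S) (h' : OutLoc blk T' S) : OutLoc blk (T - T') S := by
  intro v x hx
  rw [LinearMap.sub_apply, Pi.sub_apply, h v x hx, h' v x hx, sub_zero]

/-- `OutLoc` passes to finite sums. [folklore] -/
private theorem outLoc_sum' {g : B6.Geometry} {X : Type} (blk : X → g.Site) {ι : Type} (s : Finset ι) {T : ι → Module.End ℝ (X → ℝ)}
    {S : Set g.Site} (h : ∀ i ∈ s, OutLoc blk (T i) S) : OutLoc blk (∑ i ∈ s, T i) S := by
  classical
  induction s using Finset.induction_on with
  | empty => intro v x _; simp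
  | insert i s hi ih =>
    rw [Finset.sum_insert hi]
    exact outLoc_add' blk (h i (Finset.mem_insert_self i s)) (ih fun i' hi' => h i' (Finset.mem_insert_of_mem hi'))

/-- a further left multiplication keeps `OutLoc`. [folklore] -/
private theorem outLoc_mulOp_left' {g : B6.Geometry} {X : Type} (blk : X → g.Site) (z : X → ℝ) {T : Module.End ℝ (X → ℝ)} {S : Set g.Site}
    (h : OutLoc blk T S) : OutLoc blk (mulOp z * T) S := by
  intro v x hx
  rw [Module.End.mul_apply, mulOp_apply, h v x hx, mul_zero]

include hMha in
/-- **`N·(h_□·)` HAS OUTPUTS ON `□̃ = SbigT □`** (global frame): `N = τ_{−v}(s(□)•ε(Q*a_□Q)ρ)τ_v`, `h_□· = τ_{−v}(h^ch_□·)τ_v`, so `N·(h_□·)` is the conjugate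
of the chart-frame operator of `outLoc_QaQ_hch_chart`, and `SbigT □` is the block-map image of `Qbig` (`outLoc_conj_chart`).
[cite: Balaban1984PropagatorsII, (2.92)–(2.93) p.239, p.247, dictionary (charts)] -/
theorem outLoc_NC_hB (hM8 : 8 ≤ Mh) (hR2 : 2 * (ℓ + 1) ^ 2 ≤ R) (hP5 : ∀ μ, 5 ≤ P' μ) (hpl : Placed ℓ k P' c.1)
    (w : BondIdx (domT hN D hk) → ℝ) (cf : ℝ) :
    OutLoc (g := geomT D) (blkV1 hN D) (NC hN hk hMh1 hP4 hMha c ha hpl w cf * mulOp (hB hN D c)) (SbigT D hMh1 hP4 c) := by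
  have hP : ∀ μ, 1 ≤ P' μ := fun μ => le_trans (by norm_num) (hP4 μ)
  -- `h_□· = τ_{−v}(h^ch_□·)τ_v`
  have hh : TB (-vch (ℓ := ℓ) (m := m) (K := K) (hd := hd) (hL := hL) Mh k (svec ℓ k c.1.1 c.1.2)) * mulOp (hch hN hMh1 hP4 c) *
      TB (vch Mh k (svec ℓ k c.1.1 c.1.2)) = mulOp (hB hN D c) := by
    rw [← trV_hB hN hMh1 hP4 c, ← mulOp_eq_conj]
  have e : NC hN hk hMh1 hP4 hMha c ha hpl w cf * mulOp (hB hN D c) =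
      TB (-vch (ℓ := ℓ) (m := m) (K := K) (hd := hd) (hL := hL) Mh k (svec ℓ k c.1.1 c.1.2)) *
        ((sc hMh1 hP4 c cf • transplant (cB (tC hN hk hMh1 hP4 c ha a (wC hN hk c w) cf) (x0 ℓ Mh k c.1) (hx0 hpl) (hfit hN hMh1 hP4 hMha c ha hpl)).W
            (eB (tC hN hk hMh1 hP4 c ha a (wC hN hk c w) cf) (x0 ℓ Mh k c.1))
            (onFun (LinearMap.adjoint (tC hN hk hMh1 hP4 c ha a (wC hN hk c w) cf).D.Q ∘ₗ (tC hN hk hMh1 hP4 c ha a (wC hN hk c w) cf).D.a ∘ₗ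
              (tC hN hk hMh1 hP4 c ha a (wC hN hk c w) cf).D.Q))) *
          mulOp (hch hN hMh1 hP4 c)) *
        TB (vch Mh k (svec ℓ k c.1.1 c.1.2)) := by
    rw [← hh, NC, ← transplant_eB_eq]
    simp only [mul_assoc]
    rw [← mul_assoc (TB (vch Mh k (svec ℓ k c.1.1 c.1.2))) (TB (-vch Mh k (svec ℓ k c.1.1 c.1.2))), TB_mul_TB_neg, one_mul]
  rw [e]
  have key := outLoc_conj_chart hN D hMh1 hP (svec ℓ k c.1.1 c.1.2) (outLoc_QaQ_hch_chart hN hk hMh1 hP4 hMha c ha hM8 hR2 hP5 hpl w cf)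
  -- the block-map image of `Qbig` is `SbigT □`
  intro v x hx
  refine key v x fun hx' => hx ?_
  obtain ⟨x', hx'Q, hx'e⟩ := hx'
  have hmem : blkMap D (svec ℓ k c.1.1 c.1.2) x' ∈ QbigT D hMh1 hP4 c := Finset.mem_image_of_mem _ hx'Q
  rw [hx'e] at hmem
  exact (mem_SbigT D hMh1 hP4 c _).2 hmem

include hMha in
/-- **`hMout` FOR THE GENUINE MEMBER OF THE CUBE**: `OutLoc (geomT D) (blkV1 hN D) (Ml □ * mulOp (hB □)) (SbigT □)` — `M_□h_□ = h_□M_□ − (h_□M_□ − M_□h_□)`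
with `hdec_cube`: `h_□M_□` and `h_□N` are cut off by `supp h_□ ⊂ □⁺ ⊂ □̃`, the line-1 pieces by `supp c_e, supp c₀ ⊂ □⁺` (the hypotheses `hcfT`, `hc0T`: r03's
displayed hypotheses (iii), discharged by `…B6CubeCoeffSizesV1.cfC_supp`/`c0C_supp`), and `z·N·(h_□·)` by `outLoc_NC_hB` — the displayed hypothesis (ii)
of r03's `prop26_2136_kLevel_assembly` (`M_h = L^a ≥ 8`, `R ≥ 2L²`, `P′ ≥ 5`, placed cube).
[cite: Balaban1984PropagatorsII, (2.92)–(2.93) p.239 (supports of h_□, ζ_□ in □̃ — our paraphrase of p.239 «equal to 1 on a cube containing □ … equal to 0 outside a similar cube», not a printed sentence), (2.90)–(2.91) p.239, p.247] -/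
theorem outLoc_Ml_hB (hM8 : 8 ≤ Mh) (hR2 : 2 * (ℓ + 1) ^ 2 ≤ R) (hP5 : ∀ μ, 5 ≤ P' μ) (hpl : Placed ℓ k P' c.1)
    (w : BondIdx (domT hN D hk) → ℝ) (cf : ℝ)
    (hcfT : ∀ (e : Fin (d + 1) × Bool) (x : PBond (PV d ℓ m K hd hL) 0),
      cfC hN hk hMh1 hP4 hMha c ha hpl w cf e x ≠ 0 → blkV1 hN D x ∈ ST D hMh1 hP4 c)
    (hc0T : ∀ x : PBond (PV d ℓ m K hd hL) 0, c0C hN hk hMh1 hP4 hMha c ha hpl w cf x ≠ 0 → blkV1 hN D x ∈ ST D hMh1 hP4 c) :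
    OutLoc (g := geomT D) (blkV1 hN D) (Ml hN hk hMh1 hP4 hMha c ha hpl w cf * mulOp (hB hN D c)) (SbigT D hMh1 hP4 c) := by
  have hMh : 2 ≤ Mh := le_trans (by norm_num) hM8
  have hR : 2 * (ℓ + 1) ≤ R := le_trans (by nlinarith : 2 * (ℓ + 1) ≤ 2 * (ℓ + 1) ^ 2) hR2
  have hBsupp : ∀ x, hB hN D c x ≠ 0 → blkV1 hN D x ∈ SbigT D hMh1 hP4 c :=
    fun x hx => blkV1_mem_SbigT_of_hB_ne_zero hN D hMh hR hP4 c hx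
  have e : Ml hN hk hMh1 hP4 hMha c ha hpl w cf * mulOp (hB hN D c) =
      mulOp (hB hN D c) * Ml hN hk hMh1 hP4 hMha c ha hpl w cf -
        (mulOp (hB hN D c) * Ml hN hk hMh1 hP4 hMha c ha hpl w cf - Ml hN hk hMh1 hP4 hMha c ha hpl w cf * mulOp (hB hN D c)) :=
    (sub_sub_cancel _ _).symm
  rw [e, hdec_cube hN hk hMh1 hP4 hMha c ha hM8 hR2 hpl w cf]
  refine outLoc_sub' _ (outLoc_mulOp_mul _ hBsupp _) (outLoc_add' _ (outLoc_sub' _ ?_ ?_) (outLoc_sum' _ _ fun _ _ => ?_))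
  · exact outLoc_sum' _ _ fun e _ =>
      outLoc_mulOp_mul _ (fun x hx => ST_subset_SbigT D hMh1 hP4 c (hcfT e x hx)) _
  · intro v x hx
    rw [mulOp_apply]
    have h0 : c0C hN hk hMh1 hP4 hMha c ha hpl w cf x = 0 := by
      by_contra hne
      exact hx (ST_subset_SbigT D hMh1 hP4 c (hc0T x hne))
    rw [h0, zero_mul]
  · exact outLoc_mulOp_left' _ _ (outLoc_sub' _ (outLoc_NC_hB hN hk hMh1 hP4 hMha c ha hM8 hR2 hP5 hpl w cf) (outLoc_mulOp_mul _ hBsupp _))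

end Cube

/-! ## §5  (v1.1) `hMout` with the line-1 supports discharged -/

section Discharged

open B6GlobalChartV1 (PV domT blkV1)
open B6SectAOperatorsV1 (BondIdx)
open B6Prop26Gluing (mulOp OutLoc)
open B6Prop26KLevelSkeletonV1 (hB)
open B6Prop26KLevelSkeletonV2 (SbigT)
open B6CubeWindowV1 (Placed Ml)
open B6CubeCoeffSizesV1 (cfC_supp c0C_supp)

variable {hd : 1 ≤ d + 1} {hL : Odd (ℓ + 1) ∧ 1 < ℓ + 1} {a₀ a₁ : ℝ} {m K : ℕ} {Mh k R : ℕ} {P' : Fin (d + 1) → ℕ}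
variable (hN : ∀ μ, N0 ℓ Mh k P' μ = (PV d ℓ m K hd hL).sitesPerDir 0) {D : TDomains d ℓ Mh k P' R} (hk : k ≤ m + K)
  (hMh1 : 1 ≤ Mh) (hP4 : ∀ μ, 4 ≤ P' μ) {a : ℕ} (hMha : Mh = (ℓ + 1) ^ a) (c : ↥(cubes D.toDomains)) (ha : a₀ ≤ a₁)

/-- **`hMout` FOR THE GENUINE MEMBER OF THE CUBE, CLOSED FORM**: `OutLoc (geomT D) (blkV1 hN D) (Ml □ * mulOp (hB □)) (SbigT □)` under `M_h = L^a ≥ 8`,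
`R ≥ 2L²`, `P′ ≥ 5`, placed cube — `outLoc_Ml_hB` with the supports of `c_e`, `c₀` supplied by `…B6CubeCoeffSizesV1.cfC_supp`/`c0C_supp`; the displayed
hypothesis (ii) of r03's `prop26_2136_kLevel_assembly` by name. [cite: Balaban1984PropagatorsII, (2.92)–(2.93) p.239 (supports of h_□, ζ_□ in □̃ — our paraphrase of p.239 «equal to 1 on a cube containing □ … equal to 0 outside a similar cube», not a printed sentence), (2.90)–(2.91) p.239, p.247] -/
theorem outLoc_Ml_hB' (hM8 : 8 ≤ Mh) (hR2 : 2 * (ℓ + 1) ^ 2 ≤ R) (hP5 : ∀ μ, 5 ≤ P' μ) (hpl : Placed ℓ k P' c.1)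
    (w : BondIdx (domT hN D hk) → ℝ) (cf : ℝ) :
    OutLoc (g := geomT D) (blkV1 hN D) (Ml hN hk hMh1 hP4 hMha c ha hpl w cf * mulOp (hB hN D c)) (SbigT D hMh1 hP4 c) :=
  outLoc_Ml_hB hN hk hMh1 hP4 hMha c ha hM8 hR2 hP5 hpl w cf
    (fun e x hx => cfC_supp hN hk hMh1 hP4 hMha c ha hM8 hR2 hP5 hpl w cf e x hx)
    (fun x hx => c0C_supp hN hk hMh1 hP4 hMha c ha hM8 hR2 hP5 hpl w cf x hx)

end Discharged

end Literature.MathematicalPhysics.QuantumFieldTheory.Balaban1983to89.B6CubeMoutV1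

end
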